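import Mathlib.Analysis.Matrix.PosDef
import Mathlib.LinearAlgebra.Matrix.Block
import Literature.AlgebraicGeometry.Motives.HodgeStructureExteriorPowerLefschetzDual
import Literature.LinearAlgebra.Alternating.ExteriorAlgebraLinearIndependence
import Literature.LinearAlgebra.Alternating.GradedForms
import HarnessLib

/-!
# Venture HSemireg — the POSITIVITY INPUT `∫_X bⁿ > 0` of the MOD-4 PARITY LAW (S3): top wedge power of a
# `(1,1)`-form `= det ×` top power of the reference form (TRACK S4-PUSH (ii), seat `s4-prove-1`;
# files of record `s4push/prove-1/ATTEMPT-1.md`, `theory/FORMULA-N-th7.md` §D (Σ6), `general-structure/STRUCTURE.md` §2 (S3))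

HONEST FRAMING. Lean index of the computation cell `pub-hsemireg`. FINITE-DIMENSIONAL EXTERIOR ALGEBRA ONLY
(Mathlib's `ExteriorAlgebra K W` for a module `W` with a basis indexed by `Fin g ⊕ Fin g`, read as the constant
Dolbeault frame `dz₁, …, dz_g, dz̄₁, …, dz̄_g` of the cell's dictionary (D1)): no abelian variety, no line bundle,
no sheaf, no Mukai pairing, no secant plane and no semiregularity map is constructed here. Nothing here says that
HC, HC_CM or HC_AV holds, and nothing here is a new case of anything.

*What it indexes (on paper, NOT in this file).* The parity law (S3) / (Σ6) computes, for a `K`-secant class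
`v = xℓ + x̄ℓ̄`, `ℓ = c·e^B`, `B = a + √-d·b` (`a, b ∈ NS(X)_ℚ`, `b` non-degenerate) on an abelian `n`-fold `X`,
`(v,v)_χ = 2|xc|² (-4d)^{n/2} ∫_X bⁿ / n!` (`n` even) and needs the SIGN of `∫_X bⁿ` — hypothesis (H1)
`∫_X bⁿ > 0` of FORMULA-N §D (ref-4 13:46:16Z).  In the constant frame `b = Σ_{j,k} h_{jk} dz_j ∧ dz̄_k` with `h`
the Hermitian matrix of `b`, and the present file proves the linear algebra that turns (H1) into a statement about
`h`: **`bᵍ = det(h) · ω₀ᵍ`** where `ω₀ = Σ_j dz_j ∧ dz̄_j` (`oneOneForm_pow_eq_det_smul_twoVector_pow`), and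
**`ω₀ᵍ = g! · (dz₁ ∧ dz̄₁) ∧ ⋯ ∧ (dz_g ∧ dz̄_g)`** (`twoVector_pow_eq_factorial_smul_volForm`); over `ℂ`,
`det h > 0` for `h` positive definite (Mathlib `Matrix.PosDef.det_pos`), `= det(-h) > 0` for `h` NEGATIVE definite
and `g` EVEN (`oneOneForm_pow_of_neg_posDef_of_even`), and `det h < 0` happens for non-degenerate INDEFINITE `h`
(`oneOneForm_pow_diagonal`, the `example`s: a non-degenerate `(1,1)`-form on a FOURFOLD frame with `b⁴ = -ω₀⁴`).
With the printed dictionary — the natural positive orientation of `V = T₀X` is `(i/2)ᵍ dv₁∧dv̄₁∧⋯∧dv_g∧dv̄_g` and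
`∫_X ∧ᵍ c₁(L) = g!·χ(L) = (-1)ˢ g!·d₁⋯d_g`, `s` = number of negative eigenvalues of `c₁(L)`
[Lange 2023, Thm. 1.7.1 (Analytic Riemann–Roch), Thm. 1.7.3 (Geometric Riemann–Roch), proof of Lemma 1.7.5] —
this reads: **`∫_X bⁿ > 0 ⟺ index(b) even`**; in particular (H1) HOLDS whenever `b` or `-b` is a polarisation
(index `0` or `n`) and `n` is even — the case of every structure of record (`b ∝ Θ`) and of every `K`-secant whose
plane `P` POLARISES `X × X̂` [Markman arXiv:2502.03415, Assumption 2.4.1 + Prop. 2.4.4, whose proof with `Θ`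
replaced by `b` gives `g_P(x,x) = -4d·b(ȳ ∧ I y)`, seat-derived in ATTEMPT-1.md §2] — and (H1) FAILS for
`b` of odd index (then the same Mukai-pairing argument excludes `n ≡ 2 (mod 4)` instead: the general form of the
law is `n + 2·index(b) ≡ 2 (mod 4)`, ATTEMPT-1.md §3).  None of that dictionary is formalised here.

CONTENT (all PROVED, 0 sorry, three definitions with bodies, no named facts), namespace
`Summit.Ventures.HSemireg.SecantParity`; `b : Basis (Fin g ⊕ Fin g) K W`, `ω₀ := twoVector b` (the tree's
Darboux 2-vector of `Literature/AlgebraicGeometry/Motives/HodgeStructureExteriorPowerLefschetz`):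
* `map_eq_det_smul_of_mem_top` — `⋀(f)` acts on the top exterior power `⋀ᴺ W` (`N = dim W`) by `det f`
  (Bourbaki Alg. III §7 no. 9 Thm. 2 / formula (23), from the tree's `ιMulti_eq_det_smul_ιMulti`);
* `oneOneForm b M := Σ_{j,k} M j k • dz_j ∧ dz̄_k` (`oneOneForm_mem_two`: `∈ ⋀² W`); `oneOneForm_one` (`M = 1` gives `ω₀`); `frameMap b M`
  (`dz_j ↦ dz_j`, `dz̄_j ↦ Σ_k M j k dz̄_k`), `det_frameMap` (`= det M`), `map_frameMap_twoVector` (`⋀(frameMap) ω₀ = β_M`);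
* **`oneOneForm_pow_eq_det_smul_twoVector_pow`** — `β_Mᵍ = det M • ω₀ᵍ` (any commutative ring, any `M`);
* `sum_pow_eq_factorial_nsmul_prod` — `(Σᵢ cᵢ)ᵐ = m!·c₁⋯c_m` and `(Σᵢ cᵢ)^{m+1} = 0` for `m` pairwise commuting
  elements of square zero in any ring (via the tree's `Commute.add_pow_succ_of_sq_eq_zero`); `volForm b := (dz₁∧dz̄₁)⋯(dz_g∧dz̄_g)`;
  **`twoVector_pow_eq_factorial_smul_volForm`** (`ω₀ᵍ = g!·volForm`), `oneOneForm_pow_eq_smul_volForm`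
  (`β_Mᵍ = (g!·det M)·volForm`), `twoVector_pow_succ_eq_zero` (`ω₀^{g+1} = 0`);
* `trace_oneOneForm_pow` (field of characteristic `0`) — `τ_{ω₀}(β_Mᵍ) = g!·det M` for the tree's top trace
  `ExteriorLefschetz.trace` normalised by `τ(ω₀ᵍ) = g!`;
* over `ℂ` (`open scoped ComplexOrder`): `oneOneForm_pow_of_posDef` (`h` positive definite: coefficient `det h`,
  `0 < det h`, i.e. `0 < (det h).re ∧ (det h).im = 0`), `oneOneForm_pow_of_neg_posDef_of_even` (`-h` positive
  definite and `g` even: coefficient `det(-h) > 0`), `oneOneForm_pow_diagonal` (`diag(d)`: coefficient `∏ dᵢ`) and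
  two `example`s at `g = 4`, `d = (1,1,1,-1)`: `β⁴ = -ω₀⁴` with `ω₀⁴ ≠ 0`.

## References

* [Lange2023AbelianVarietiesComplex] H. Lange, Abelian Varieties over the Complex Numbers, Springer (2023), §1.7:
  Thm. 1.7.1, Thm. 1.7.3, Lemma 1.7.4, Lemma 1.7.5 and its proof (held `book:lange1992-complex-abelian-varieties`,
  pp. 71–73 of the held text).
* [Markman2025SecantWeil] E. Markman, Cycles on abelian 2n-folds of Weil type from secant sheaves on abelian
  n-folds, arXiv:2502.03415 (UNREFEREED), Assumption 2.4.1, Lemma 2.4.2, Prop. 2.4.4.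
* [BourbakiAlgebraI1989] N. Bourbaki, Algebra I, Ch. III §7 no. 9, Thm. 2 and formula (23).
* [VoisinHodgeI2002] C. Voisin, Hodge Theory and Complex Algebraic Geometry I (2002), §3.1.3 Lemma 3.8
  (`ωⁿ/n!` is the volume form).
-/

noncomputable section

namespace Summit.Ventures.HSemireg

namespace SecantParity

open ExteriorAlgebra
open Literature.AlgebraicGeometry.Motives.ExteriorLefschetz (twoVector twoVector_mem pow_mem_exteriorPower
  isSymplectic_twoVector mul_comm_of_mem_two IsSymplectic)
open Literature.LinearAlgebra.Alternating (ιMulti_eq_det_smul_ιMulti)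

section CommRing

variable {K : Type*} [CommRing K] {W : Type*} [AddCommGroup W] [Module K W]

/-! ### §1 `⋀(f)` acts on the top exterior power by `det f` -/

/-- **The top exterior power is the determinant**: for a module `W` with a finite basis `B` indexed by `Fin N`
and an endomorphism `f`, `⋀(f) x = det f • x` for every `x ∈ ⋀ᴺ W` (on `x = x₁ ∧ ⋯ ∧ x_N`:
`f x₁ ∧ ⋯ ∧ f x_N = det_B(f ∘ x)·B₁ ∧ ⋯ ∧ B_N = det f · det_B(x)·B₁ ∧ ⋯ ∧ B_N`, the tree's
`ιMulti_eq_det_smul_ιMulti` and Mathlib's `Basis.det_comp`; the `x₁ ∧ ⋯ ∧ x_N` span `⋀ᴺ W`).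
[cite: BourbakiAlgebraI1989, Ch. III §7 no. 9 Thm. 2, formula (23)] -/
theorem map_eq_det_smul_of_mem_top {N : ℕ} (B : Module.Basis (Fin N) K W) (f : W →ₗ[K] W)
    {x : ExteriorAlgebra K W} (hx : x ∈ ⋀[K]^N W) :
    ExteriorAlgebra.map f x = LinearMap.det f • x := by
  rw [← ιMulti_span_fixedDegree] at hx
  induction hx using Submodule.span_induction with
  | mem y hy =>
    obtain ⟨v, rfl⟩ := hy
    rw [map_apply_ιMulti, ιMulti_eq_det_smul_ιMulti B (f ∘ v), Module.Basis.det_comp, mul_smul,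
      ← ιMulti_eq_det_smul_ιMulti B v]
  | zero => rw [map_zero, smul_zero]
  | add y z _ _ hy hz => rw [map_add, smul_add, hy, hz]
  | smul c y _ hy => rw [map_smul, hy, smul_comm]

/-! ### §2 The `(1,1)`-form of a coefficient matrix in a split frame, and its top power -/

variable {g : ℕ} (b : Module.Basis (Fin g ⊕ Fin g) K W)

/-- **The `(1,1)`-form with coefficient matrix `M`** in the split frame `b` (`dz_j := b (inl j)`,
`dz̄_k := b (inr k)`): `β_M := Σ_{j,k} M j k • dz_j ∧ dz̄_k`.  For `M = h` the Hermitian matrix of an invariant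
`(1,1)`-form on a complex torus this is that form in the constant Dolbeault frame (up to the positive factor
`i/2` of the convention in use). [cite: Lange2023AbelianVarietiesComplex, §1.7 Lemma 1.7.4] -/
def oneOneForm (M : Matrix (Fin g) (Fin g) K) : ExteriorAlgebra K W :=
  ∑ j, ∑ k, M j k • (ι K (b (Sum.inl j)) * ι K (b (Sum.inr k)))

/-- `β_M ∈ ⋀² W`. [folklore] -/
theorem oneOneForm_mem_two (M : Matrix (Fin g) (Fin g) K) : oneOneForm b M ∈ ⋀[K]^2 W := by
  refine Submodule.sum_mem _ fun j _ ↦ Submodule.sum_mem _ fun k _ ↦ Submodule.smul_mem _ _ ?_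
  rw [exteriorPower, pow_two]
  exact Submodule.mul_mem_mul (LinearMap.mem_range_self _ _) (LinearMap.mem_range_self _ _)

/-- `β_1 = ω₀ = Σ_j dz_j ∧ dz̄_j`, the tree's Darboux 2-vector `twoVector b`.
[cite: Lange2023AbelianVarietiesComplex, §1.7 Lemma 1.7.4] -/
theorem oneOneForm_one : oneOneForm b (1 : Matrix (Fin g) (Fin g) K) = twoVector b := by
  unfold oneOneForm twoVector
  refine Finset.sum_congr rfl fun j _ ↦ ?_
  rw [Finset.sum_eq_single j]
  · rw [Matrix.one_apply_eq, one_smul]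
  · intro k _ hkj
    rw [Matrix.one_apply_ne' hkj, zero_smul]
  · intro h
    exact absurd (Finset.mem_univ j) h

/-- `β_M` is additive in `M`. [folklore] -/
theorem oneOneForm_add (M N : Matrix (Fin g) (Fin g) K) :
    oneOneForm b (M + N) = oneOneForm b M + oneOneForm b N := by
  unfold oneOneForm
  simp only [Matrix.add_apply, add_smul, Finset.sum_add_distrib]

/-- `β_{c M} = c • β_M`. [folklore] -/
theorem oneOneForm_smul (c : K) (M : Matrix (Fin g) (Fin g) K) :
    oneOneForm b (c • M) = c • oneOneForm b M := by
  unfold oneOneForm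
  simp only [Matrix.smul_apply, smul_eq_mul, mul_smul, Finset.smul_sum]

/-- `β_{-M} = -β_M`. [folklore] -/
theorem oneOneForm_neg (M : Matrix (Fin g) (Fin g) K) : oneOneForm b (-M) = -oneOneForm b M := by
  rw [← neg_one_smul K M, oneOneForm_smul, neg_one_smul]

/-- The block matrix `diag(1, Mᵀ)` of the frame change in the basis `b`. [folklore] -/
def frameMatrix (M : Matrix (Fin g) (Fin g) K) : Matrix (Fin g ⊕ Fin g) (Fin g ⊕ Fin g) K :=
  Matrix.fromBlocks 1 0 0 M.transpose

/-- **The frame change** `dz_j ↦ dz_j`, `dz̄_j ↦ Σ_k M j k • dz̄_k` as an endomorphism of `W`.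
[cite: BourbakiAlgebraI1989, Ch. III §7 no. 9 Thm. 2] -/
def frameMap (M : Matrix (Fin g) (Fin g) K) : W →ₗ[K] W :=
  Matrix.toLin b b (frameMatrix M)

/-- `frameMap` fixes the `dz_j`. [folklore] -/
theorem frameMap_inl (M : Matrix (Fin g) (Fin g) K) (j : Fin g) :
    frameMap b M (b (Sum.inl j)) = b (Sum.inl j) := by
  rw [frameMap, Matrix.toLin_self, Fintype.sum_sum_type]
  simp only [frameMatrix, Matrix.fromBlocks_apply₁₁, Matrix.fromBlocks_apply₂₁, Matrix.zero_apply, zero_smul,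
    Finset.sum_const_zero, add_zero]
  rw [Finset.sum_eq_single j]
  · rw [Matrix.one_apply_eq, one_smul]
  · intro i _ hij
    rw [Matrix.one_apply_ne hij, zero_smul]
  · intro h
    exact absurd (Finset.mem_univ j) h

/-- `frameMap` sends `dz̄_j` to `Σ_k M j k • dz̄_k`. [folklore] -/
theorem frameMap_inr (M : Matrix (Fin g) (Fin g) K) (j : Fin g) :
    frameMap b M (b (Sum.inr j)) = ∑ k, M j k • b (Sum.inr k) := by
  rw [frameMap, Matrix.toLin_self, Fintype.sum_sum_type]
  simp only [frameMatrix, Matrix.fromBlocks_apply₁₂, Matrix.fromBlocks_apply₂₂, Matrix.zero_apply, zero_smul,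
    Finset.sum_const_zero, zero_add, Matrix.transpose_apply]

/-- `det (frameMap b M) = det M`. [cite: BourbakiAlgebraI1989, Ch. III §7 no. 9 Thm. 2] -/
theorem det_frameMap (M : Matrix (Fin g) (Fin g) K) : LinearMap.det (frameMap b M) = M.det := by
  rw [frameMap, LinearMap.det_toLin, frameMatrix, Matrix.det_fromBlocks_zero₂₁, Matrix.det_one, one_mul,
    Matrix.det_transpose]

/-- **`⋀(frameMap) ω₀ = β_M`**: the frame change carries the reference form to the form with matrix `M`.
[cite: Lange2023AbelianVarietiesComplex, §1.7 Lemma 1.7.4] -/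
theorem map_frameMap_twoVector (M : Matrix (Fin g) (Fin g) K) :
    ExteriorAlgebra.map (frameMap b M) (twoVector b) = oneOneForm b M := by
  unfold twoVector oneOneForm
  rw [map_sum]
  refine Finset.sum_congr rfl fun j _ ↦ ?_
  rw [map_mul, map_apply_ι, map_apply_ι, frameMap_inl, frameMap_inr, map_sum, Finset.mul_sum]
  refine Finset.sum_congr rfl fun k _ ↦ ?_
  rw [map_smul, mul_smul_comm]

/-- The basis `b` re-indexed by `Fin (g + g)` (to speak of the top power `⋀^{g+g} W`). [folklore] -/
def finBasis : Module.Basis (Fin (g + g)) K W := b.reindex finSumFinEquiv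

/-- `ω₀ᵍ ∈ ⋀^{g+g} W` (top degree). [cite: BourbakiAlgebraI1989, Ch. III §7 no. 1] -/
theorem twoVector_pow_mem_top : twoVector b ^ g ∈ ⋀[K]^(g + g) W := by
  rw [← two_mul]
  exact pow_mem_exteriorPower (twoVector_mem b) g

/-- **TOP POWER OF A `(1,1)`-FORM = DETERMINANT × TOP POWER OF THE REFERENCE FORM**:
`β_Mᵍ = det M • ω₀ᵍ` in `⋀^{2g} W`, for every commutative ring `K` and every `g × g` matrix `M`
(`β_M = ⋀(φ_M) ω₀` for the frame change `φ_M`, `⋀(φ_M)` is multiplicative, and acts on the top power by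
`det φ_M = det M`).  With the printed dictionary `∧ᵍ c₁(L) = (-1)ᵍ g!·d₁⋯d_g·dx₁∧dy₁∧⋯` /
`∫_X ∧ᵍ c₁(L) = (-1)ˢ g!·d₁⋯d_g` this is the algebra behind "the sign of `∫_X bᵍ` is `(-1)^{index(b)}`".
[cite: Lange2023AbelianVarietiesComplex, Thm. 1.7.1, Thm. 1.7.3 and proof of Lemma 1.7.5] -/
theorem oneOneForm_pow_eq_det_smul_twoVector_pow (M : Matrix (Fin g) (Fin g) K) :
    oneOneForm b M ^ g = M.det • twoVector b ^ g := by
  rw [← map_frameMap_twoVector, ← map_pow, map_eq_det_smul_of_mem_top (finBasis b) (frameMap b M)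
    (twoVector_pow_mem_top b), det_frameMap]

/-! ### §3 `ω₀ᵍ = g! · (dz₁ ∧ dz̄₁) ⋯ (dz_g ∧ dz̄_g)` -/

/-- **`(Σᵢ cᵢ)ᵐ = m!·c₁⋯c_m` and `(Σᵢ cᵢ)^{m+1} = 0`** for `m` pairwise commuting elements of square zero
in a ring (induction on `m`, peeling one summand off with the tree's `Commute.add_pow_succ_of_sq_eq_zero`:
`(a + S)^{k+1} = S^{k+1} + (k+1)·a·Sᵏ` for `aS = Sa`, `a² = 0`). [folklore] -/
theorem sum_pow_eq_factorial_nsmul_prod {A : Type*} [Ring A] :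
    ∀ (m : ℕ) (c : Fin m → A), (∀ i j, Commute (c i) (c j)) → (∀ i, c i * c i = 0) →
      (∑ i, c i) ^ m = m.factorial • (List.ofFn c).prod ∧ (∑ i, c i) ^ (m + 1) = 0
  | 0, c, _, _ => by simp
  | m + 1, c, hc, hsq => by
    obtain ⟨ih₁, ih₂⟩ := sum_pow_eq_factorial_nsmul_prod m (fun i ↦ c i.succ) (fun i j ↦ hc _ _) (fun i ↦ hsq _)
    have hcomm : Commute (c 0) (∑ i : Fin m, c i.succ) := Commute.sum_right _ _ _ fun i _ ↦ hc _ _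
    rw [Fin.sum_univ_succ, List.ofFn_succ, List.prod_cons]
    refine ⟨?_, ?_⟩
    · rw [hcomm.add_pow_succ_of_sq_eq_zero (hsq 0) m, ih₂, zero_add, ih₁, mul_smul_comm, smul_smul,
        Nat.factorial_succ]
    · rw [hcomm.add_pow_succ_of_sq_eq_zero (hsq 0) (m + 1), ih₂, mul_zero, smul_zero, add_zero,
        pow_succ, ih₂, zero_mul]

/-- **The frame volume element** `volForm b := (dz₁ ∧ dz̄₁)(dz₂ ∧ dz̄₂) ⋯ (dz_g ∧ dz̄_g)` (interleaved order; for
`dz_j = dv_j`, `dz̄_j = dv̄_j` this is `(2/i)ᵍ` times the natural positive orientation `(i/2)ᵍ dv₁∧dv̄₁∧⋯∧dv_g∧dv̄_g`).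
[cite: Lange2023AbelianVarietiesComplex, §1.7 proof of Lemma 1.7.5] -/
def volForm : ExteriorAlgebra K W :=
  (List.ofFn fun j : Fin g ↦ ι K (b (Sum.inl j)) * ι K (b (Sum.inr j))).prod

/-- `dz_j ∧ dz̄_k` lies in `⋀² W`. [folklore] -/
theorem ι_mul_ι_mem_two (v w : W) : ι K v * ι K w ∈ ⋀[K]^2 W := by
  rw [exteriorPower, pow_two]
  exact Submodule.mul_mem_mul (LinearMap.mem_range_self _ _) (LinearMap.mem_range_self _ _)

/-- `(v ∧ w)(v ∧ w') = 0` in the exterior algebra. [folklore] -/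
theorem ι_mul_ι_mul_ι_mul_ι_eq_zero (v w w' : W) : ι K v * ι K w * (ι K v * ι K w') = 0 := by
  have h : ι K w * ι K v = -(ι K v * ι K w) := eq_neg_of_add_eq_zero_left (ι_add_mul_swap w v)
  calc ι K v * ι K w * (ι K v * ι K w') = ι K v * (ι K w * ι K v) * ι K w' := by simp only [mul_assoc]
    _ = -(ι K v * ι K v * ι K w * ι K w') := by rw [h, mul_neg, neg_mul, ← mul_assoc]
    _ = 0 := by rw [ι_sq_zero, zero_mul, zero_mul, neg_zero]

/-- **`ω₀ᵍ = g! · volForm`**: the top power of the reference form `Σ_j dz_j ∧ dz̄_j` is `g!` times the frame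
volume element (the summands commute pairwise and square to zero). [cite: VoisinHodgeI2002, §3.1.3 Lemma 3.8] -/
theorem twoVector_pow_eq_factorial_smul_volForm : twoVector b ^ g = (g.factorial : K) • volForm b := by
  have h := (sum_pow_eq_factorial_nsmul_prod g (fun j : Fin g ↦ ι K (b (Sum.inl j)) * ι K (b (Sum.inr j)))
    (fun _ _ ↦ mul_comm_of_mem_two (ι_mul_ι_mem_two _ _) _) (fun _ ↦ ι_mul_ι_mul_ι_mul_ι_eq_zero _ _ _)).1
  rw [Nat.cast_smul_eq_nsmul]
  exact h

/-- **`ω₀^{g+1} = 0`** (top degree is `2g`). [cite: BourbakiAlgebraI1989, Ch. III §7 no. 1] -/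
theorem twoVector_pow_succ_eq_zero : twoVector b ^ (g + 1) = 0 :=
  (sum_pow_eq_factorial_nsmul_prod g (fun j : Fin g ↦ ι K (b (Sum.inl j)) * ι K (b (Sum.inr j)))
    (fun _ _ ↦ mul_comm_of_mem_two (ι_mul_ι_mem_two _ _) _) (fun _ ↦ ι_mul_ι_mul_ι_mul_ι_eq_zero _ _ _)).2

/-- **`β_Mᵍ = (g! · det M) · volForm`**: top power of the `(1,1)`-form with matrix `M` against the frame volume
element. [cite: Lange2023AbelianVarietiesComplex, Thm. 1.7.3 and proof of Lemma 1.7.5] -/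
theorem oneOneForm_pow_eq_smul_volForm (M : Matrix (Fin g) (Fin g) K) :
    oneOneForm b M ^ g = ((g.factorial : K) * M.det) • volForm b := by
  rw [oneOneForm_pow_eq_det_smul_twoVector_pow, twoVector_pow_eq_factorial_smul_volForm, smul_smul, mul_comm]

/-- The diagonal case: `β_{diag d}ᵍ = (∏ᵢ dᵢ) • ω₀ᵍ` — in a frame diagonalising `b`, the sign of the top power
is the parity of the number of negative entries. [cite: Lange2023AbelianVarietiesComplex, Thm. 1.7.1 and Lemma 1.7.4] -/
theorem oneOneForm_pow_diagonal (d : Fin g → K) :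
    oneOneForm b (Matrix.diagonal d) ^ g = (∏ i, d i) • twoVector b ^ g := by
  rw [oneOneForm_pow_eq_det_smul_twoVector_pow, Matrix.det_diagonal]

end CommRing

section Field

variable {K : Type*} [Field K] [CharZero K] {W : Type*} [AddCommGroup W] [Module K W] {g : ℕ}
  (b : Module.Basis (Fin g ⊕ Fin g) K W)

/-- **`τ_{ω₀}(β_Mᵍ) = g! · det M`** for the tree's top-degree trace `τ_{ω₀}` normalised by `τ(ω₀ᵍ) = g!`
(`ExteriorLefschetz.trace`, `IsSymplectic.trace_pow`): "`∫ bᵍ = det(h) · ∫ ω₀ᵍ`".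
[cite: VoisinHodgeI2002, §6.3.2 (p. 128)] -/
theorem trace_oneOneForm_pow (M : Matrix (Fin g) (Fin g) K) :
    Literature.AlgebraicGeometry.Motives.ExteriorLefschetz.trace (twoVector b) g (oneOneForm b M ^ g) =
      (g.factorial : K) * M.det := by
  rw [oneOneForm_pow_eq_det_smul_twoVector_pow, map_smul, (isSymplectic_twoVector b).trace_pow, smul_eq_mul,
    mul_comm]

/-- `ω₀ᵍ ≠ 0` over a field of characteristic `0` (so the coefficients above are honest: `β_Mᵍ = 0 ⟺ det M = 0`).
[cite: Lange2023AbelianVarietiesComplex, §7.3.2 (1)] -/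
theorem twoVector_pow_ne_zero : twoVector b ^ g ≠ 0 :=
  (isSymplectic_twoVector b).pow_ne_zero

/-- `β_Mᵍ = 0 ⟺ det M = 0` (over a field of characteristic `0`). [folklore] -/
theorem oneOneForm_pow_eq_zero_iff (M : Matrix (Fin g) (Fin g) K) : oneOneForm b M ^ g = 0 ↔ M.det = 0 := by
  rw [oneOneForm_pow_eq_det_smul_twoVector_pow, smul_eq_zero, or_iff_left (twoVector_pow_ne_zero b)]

end Field

section Complex

open scoped ComplexOrder

variable {W : Type*} [AddCommGroup W] [Module ℂ W] {g : ℕ} (b : Module.Basis (Fin g ⊕ Fin g) ℂ W)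

/-- **POSITIVE DEFINITE ⇒ POSITIVE TOP POWER**: for a positive definite Hermitian `h`, `β_hᵍ = det h • ω₀ᵍ` with
`0 < det h` (a positive real number: `0 < (det h).re` and `(det h).im = 0`) — the case `index(b) = 0`
(`b` a polarisation): `∫_X bᵍ = g!·d₁⋯d_g > 0`. [cite: Lange2023AbelianVarietiesComplex, Thm. 1.7.1 and Thm. 1.7.3] -/
theorem oneOneForm_pow_of_posDef {h : Matrix (Fin g) (Fin g) ℂ} (hh : h.PosDef) :
    oneOneForm b h ^ g = h.det • twoVector b ^ g ∧ 0 < h.det ∧ (0 < h.det.re ∧ h.det.im = 0) := by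
  refine ⟨oneOneForm_pow_eq_det_smul_twoVector_pow b h, hh.det_pos, ?_⟩
  have hp := hh.det_pos
  rw [Complex.pos_iff] at hp
  exact ⟨hp.1, hp.2.symm⟩

/-- **NEGATIVE DEFINITE AND `g` EVEN ⇒ POSITIVE TOP POWER**: if `-h` is positive definite and `g` is even then
`β_hᵍ = det(-h) • ω₀ᵍ` with `0 < det(-h)` — the case `index(b) = g`, `g` even (`-b` a polarisation): the sign
`(-1)ˢ = (-1)ᵍ = +1`.  This and the previous theorem are hypothesis (H1) of the parity law for `±b` ample, `n` even.
[cite: Lange2023AbelianVarietiesComplex, Thm. 1.7.1 and Thm. 1.7.3] -/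
theorem oneOneForm_pow_of_neg_posDef_of_even {h : Matrix (Fin g) (Fin g) ℂ} (hh : (-h).PosDef) (hg : Even g) :
    oneOneForm b h ^ g = (-h).det • twoVector b ^ g ∧ 0 < (-h).det := by
  refine ⟨?_, hh.det_pos⟩
  rw [← oneOneForm_pow_eq_det_smul_twoVector_pow, oneOneForm_neg, hg.neg_pow]

/-- **SIGN OF THE TOP POWER = `(-1)^{index}`** (the general non-degenerate Hermitian case): for a Hermitian `h`
with `det h ≠ 0` and `s :=` the number of negative eigenvalues of `h` (the INDEX of the `(1,1)`-form),
`det h = (-1)ˢ · ∏ᵢ |λᵢ|` with `∏ᵢ |λᵢ| > 0`; so `β_hᵍ = ((-1)ˢ · ∏ᵢ |λᵢ|) • ω₀ᵍ` — Lange's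
`χ(L) = (-1)ˢ d₁⋯d_g`, `∫_X ∧ᵍ c₁(L) = g!·χ(L)` read in the frame: **`∫_X bᵍ > 0 ⟺ s even`**, the exact form of
hypothesis (H1) (and the source of the general parity constraint `n + 2s ≡ 2 (mod 4)` of ATTEMPT-1.md §3).
[cite: Lange2023AbelianVarietiesComplex, Thm. 1.7.1 and Thm. 1.7.3] -/
theorem oneOneForm_pow_of_isHermitian {h : Matrix (Fin g) (Fin g) ℂ} (hh : h.IsHermitian) (hdet : h.det ≠ 0) :
    oneOneForm b h ^ g =
        ((-1 : ℂ) ^ (Finset.univ.filter (fun i ↦ hh.eigenvalues i < 0)).card *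
          ((∏ i, |hh.eigenvalues i| : ℝ) : ℂ)) • twoVector b ^ g ∧
      0 < ∏ i, |hh.eigenvalues i| := by
  have hne : ∀ i, hh.eigenvalues i ≠ 0 := by
    intro i hi
    apply hdet
    rw [hh.det_eq_prod_eigenvalues]
    exact Finset.prod_eq_zero (Finset.mem_univ i) (by rw [hi]; simp)
  refine ⟨?_, Finset.prod_pos fun i _ ↦ abs_pos.mpr (hne i)⟩
  rw [oneOneForm_pow_eq_det_smul_twoVector_pow, hh.det_eq_prod_eigenvalues]
  congr 1
  have key : ∀ i, (RCLike.ofReal (hh.eigenvalues i) : ℂ) =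
      (if hh.eigenvalues i < 0 then (-1 : ℂ) else 1) * ((|hh.eigenvalues i| : ℝ) : ℂ) := by
    intro i
    show ((hh.eigenvalues i : ℝ) : ℂ) = _
    split_ifs with hlt
    · rw [abs_of_neg hlt, Complex.ofReal_neg, neg_one_mul, neg_neg]
    · rw [abs_of_nonneg (not_lt.mp hlt), one_mul]
  calc ∏ i, (RCLike.ofReal (hh.eigenvalues i) : ℂ)
      = ∏ i, ((if hh.eigenvalues i < 0 then (-1 : ℂ) else 1) * ((|hh.eigenvalues i| : ℝ) : ℂ)) :=
        Finset.prod_congr rfl fun i _ ↦ key i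
    _ = (-1 : ℂ) ^ (Finset.univ.filter (fun i ↦ hh.eigenvalues i < 0)).card * ((∏ i, |hh.eigenvalues i| : ℝ) : ℂ) := by
        rw [Finset.prod_mul_distrib, Finset.prod_ite, Finset.prod_const_one, mul_one, Finset.prod_const,
          Complex.ofReal_prod]

/-- INDEFINITE, NON-DEGENERATE, ODD INDEX: on a FOURFOLD frame (`g = 4`) the `(1,1)`-form with matrix
`diag(1, 1, 1, -1)` has `β⁴ = -ω₀⁴` — a non-degenerate `(1,1)`-form whose top power is a NEGATIVE multiple of the
reference top form: hypothesis (H1) is NOT a consequence of non-degeneracy (index `1`, `(-1)ˢ = -1`).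
[cite: Lange2023AbelianVarietiesComplex, Thm. 1.7.1] -/
example (b₄ : Module.Basis (Fin 4 ⊕ Fin 4) ℂ W) :
    oneOneForm b₄ (Matrix.diagonal ![1, 1, 1, -1]) ^ 4 = -(twoVector b₄ ^ 4) := by
  rw [oneOneForm_pow_diagonal, Fin.prod_univ_four]
  simp

/-- … and that multiple is genuinely negative: `ω₀⁴ ≠ 0`. [cite: Lange2023AbelianVarietiesComplex, §7.3.2 (1)] -/
example (b₄ : Module.Basis (Fin 4 ⊕ Fin 4) ℂ W) :
    oneOneForm b₄ (Matrix.diagonal ![1, 1, 1, -1]) ^ 4 ≠ 0 := by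
  rw [Ne, oneOneForm_pow_eq_zero_iff, Matrix.det_diagonal, Fin.prod_univ_four]
  simp

end Complex

end SecantParity

end Summit.Ventures.HSemireg
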